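import Mathlib
import HarnessLib
import Summits.NavierStokesRegularity.NavierStokesRegularity.Theorems.PoloidalWindowDoorPoloidalWindowRigiditySlopeFunctionPressure
import Summits.NavierStokesRegularity.NavierStokesRegularity.Theorems.PoloidalWindowDoorPoloidalWindowRigidityZShockSlopeFunctionSpaceTime

/-!
# Crux K2 `PoloidalWindowRigidity` (stmt-NavierStokesRegularity-19708), line `z_shock` — bridge B2: the PRESSURE LAW of the stratum (SF)
# holds LOCALLY, hence on the z_shock Aut column at every slab point off `{∇ₕv₂ = 0}`

`--supports stmt-NavierStokesRegularity-19708 --as helper` (leafhand-ns-poloidalwindowdoor-3 g13, cell decomp-ns, 2026-08-31).  Def-free.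
**No stub and no summit is closed by this file; Navier–Stokes regularity is NOT proved here (rung 0).**

K2-p2's `…SlopeFunctionPressure.slopeFunction_pressure` (the Navier–Stokes identity of the stratum (SF) «`∂_z v_b = m(t, v₂)·∂_b v₂`»,
obtained by applying the material operator `𝓛 = ∂ₜ + v·∇ − Δ` to the constraint) is stated for a slope law holding on ALL slices `s < 0`
and all points.  Its proof is pointwise: it uses the constraint only through the time-germ at `x`, the space-germ at time `t`, and the
values at `(t, x)`.  This file records the LOCAL form and composes it with bridge B1 (`…ZShockSlopeFunctionSpaceTime`):

* `slopeFunction_pressure_local` — the pressure law at `(t, x)` from the constraint on an open space–time `O ∋ (t, x)` only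
  (`m : ℝ → ℝ → ℝ` still globally `C²`; proof = K2-p2's, with `Filter.EventuallyEq.fderiv_eq` / `InnerProductSpace.laplacian_congr_nhds`
  replacing the global rewrite of the slice);
* `exists_contDiff_eventuallyEq_of_contDiffAt` — a real function `C^ω` at a point of a finite-dimensional space agrees near that point
  with a GLOBALLY `Cⁿ` function (bump-function cut-off; `ContDiffBump`);
* ★ `slopeFunction_pressure_of_class_autonomy` — **B1 + B2 composed**: class binders of `stub_zShockThickAut` + the stub's local
  autonomy clause on an open nonempty `W₁` of the slab ⟹ at EVERY `t < 0`, `x` with `∇ₕv₂(t,x) ≠ 0` there is a globally `C²` slope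
  function `m : ℝ → ℝ → ℝ` (real-analytic near `(t, v₂(t,x))`, cut off far away) such that the constraint holds on an open space–time
  neighbourhood of `(t, x)` AND the (SF) pressure law
  `(1 − m)(∂_b f)₂ = ∂_b v₂·(m_t + m_s f₂ − m_ss‖∇v₂‖²) − 2 m_s Σᵢ ∂ᵢv₂ ∂ᵢ∂_b v₂` holds at `(t, x)` for both `b ≠ 2`.

So the z_shock Aut column carries, pointwise off the analytic set `{∇ₕv₂ = 0}`, the full (SF) pressure law of K2-p2; the next bridge (B3)
is the local form of `…SlopeFunctionSource.horizFDeriv_clebschSource_eq_zero` (differentiate this law along the slice inside `O`), after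
which the located residual of (SF) («height dependence of the Clebsch-weight source `a(t, x₂)`», `…SlopeFunctionPassive`) is literally
the open content of the Aut column.  presearch: n/a (tree-internal localisation). [folklore]
-/

noncomputable section

-- the summit and its single sub-problem share the name (CONVENTIONS §1), as in every Theorems file
set_option linter.dupNamespace false

namespace Summit.NavierStokesRegularity.NavierStokesRegularity.Theorems.PoloidalWindowDoorPoloidalWindowRigidityZShockSlopeFunctionPressureLocal

open MeasureTheory Set Function Filter Topology TopologicalSpace Metric InnerProductSpace
open scoped RealInnerProductSpace InnerProductSpace Laplacian ContDiff
open Literature.Analysis Literature.Analysis.FluidPDE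
open Summit.NavierStokesRegularity.NavierStokesRegularity.Theorems.LocalSineTubeDoorProfileAlignedWindowRigidityAncient
open Summit.NavierStokesRegularity.NavierStokesRegularity.Theorems.PoloidalWindowDoorPoloidalWindowRigidityWindow
open Summit.NavierStokesRegularity.NavierStokesRegularity.Theorems.PoloidalWindowDoorPoloidalWindowRigidityFlat
open Summit.NavierStokesRegularity.NavierStokesRegularity.Theorems.PoloidalWindowDoorPoloidalWindowRigidityVelocityGradientLaw
open Summit.NavierStokesRegularity.NavierStokesRegularity.Theorems.PoloidalWindowDoorPoloidalWindowRigiditySeparatedPressure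
open Summit.NavierStokesRegularity.NavierStokesRegularity.Theorems.PoloidalWindowDoorPoloidalWindowRigidityMaterialLeibniz
open Summit.NavierStokesRegularity.NavierStokesRegularity.Theorems.PoloidalWindowDoorPoloidalWindowRigidityVerticalSourceGauge
open Summit.NavierStokesRegularity.NavierStokesRegularity.Theorems.PoloidalWindowDoorPoloidalWindowRigiditySlopeLaw
open Summit.NavierStokesRegularity.NavierStokesRegularity.Theorems.PoloidalWindowDoorPoloidalWindowRigiditySlopeFunctionPressure
open Summit.NavierStokesRegularity.NavierStokesRegularity.Theorems.PoloidalWindowDoorPoloidalWindowRigidityZShockSlopeFunctionSpaceTime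

variable {C : ℝ} {v : ℝ → EuclideanSpace ℝ (Fin 3) → EuclideanSpace ℝ (Fin 3)}

section Class

variable (hrate : HasTypeITimeDecay C v) (hcont : ContinuousOn (uncurry v) (Iio (0 : ℝ) ×ˢ univ))
  (hmild : ∀ s t : ℝ, s < t → t < 0 → ∀ x,
    v t x = UnboundedOperators.heatExtension (v s) (t - s) x - oseenDuhamel 1 s v v t x)
  (hdiv : ∀ t < 0, VectorCalculus.IsDivFree (v t))

include hrate hcont hmild hdiv

/-! ### The pressure law of (SF), local form -/

/-- **THE PRESSURE LAW OF (SF), LOCAL FORM.**  Let `v` be a profile of the route's Type-I class, poloidal along `e₃` on every slice, and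
suppose the (SF) constraint `∂₂v_b(s,y) = m(s, v₂(s,y)) ∂_b v₂(s,y)` (`b = 0,1`) holds for all `(s, y)` in an OPEN space–time set
`O ∋ (t, x)`, for a jointly `C²` slope function `m : ℝ → ℝ → ℝ`.  Then at `(t, x)`, for the intrinsic residual `f = ∂ₜv + (v·∇)v − Δv`
(`= −∇p`) and `b = 0,1`, with `θ₀ = v₂(t,x)`:
`(1 − m(t,θ₀))·(∂_b f)₂ = ∂_b v₂·(m_t + m_s f₂ − m_ss Σᵢ(∂ᵢv₂)²) − 2 m_s Σᵢ ∂ᵢv₂ ∂ᵢ(∂_b v₂)` — verbatim the conclusion of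
`…SlopeFunctionPressure.slopeFunction_pressure`, whose proof is followed line by line. [folklore] -/
theorem slopeFunction_pressure_local
    (hpol : ∀ s < 0, ∀ y, ⟪curl (v s) y, EuclideanSpace.single 2 1⟫_ℝ = 0) {m : ℝ → ℝ → ℝ}
    (hm : ContDiff ℝ 2 (uncurry m)) {t : ℝ} (ht : t < 0) (x : EuclideanSpace ℝ (Fin 3))
    {O : Set (ℝ × EuclideanSpace ℝ (Fin 3))} (hO : IsOpen O) (hxO : (t, x) ∈ O)
    (hslope : ∀ z ∈ O, ∀ b : Fin 3, b ≠ 2 →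
      fderiv ℝ (v z.1) z.2 (EuclideanSpace.single 2 1) b =
        m z.1 (v z.1 z.2 2) * fderiv ℝ (v z.1) z.2 (EuclideanSpace.single b 1) 2)
    {b : Fin 3} (hb : b ≠ 2) :
    (1 - m t (v t x 2)) * fderiv ℝ (fun y => timeDerivWithin (Iio 0) v t y + convect (v t) (v t) y - Δ (v t) y) x
          (EuclideanSpace.single b 1) 2 =
      fderiv ℝ (v t) x (EuclideanSpace.single b 1) 2 *
          (deriv (fun τ => m τ (v t x 2)) t
            + deriv (m t) (v t x 2) * (timeDerivWithin (Iio 0) v t x + convect (v t) (v t) x - Δ (v t) x) 2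
            - deriv (deriv (m t)) (v t x 2) * ∑ i : Fin 3, fderiv ℝ (v t) x (EuclideanSpace.single i 1) 2 ^ 2)
        - 2 * deriv (m t) (v t x 2) * ∑ i : Fin 3, fderiv ℝ (v t) x (EuclideanSpace.single i 1) 2 *
            fderiv ℝ (fun y => fderiv ℝ (v t) y (EuclideanSpace.single b 1) 2) x (EuclideanSpace.single i 1) := by
  have hA : IsTypeIAncientMild C v := isTypeIAncientMild_of_class hrate hcont hmild hdiv
  have hs : ContDiff ℝ ∞ (v t) := hA.contDiff_slice ht
  have hsd : Differentiable ℝ (v t) := hs.differentiable (by simp)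
  have hb' : b = 0 ∨ b = 1 := by
    fin_cases b <;> simp at hb ⊢
  -- ## the two velocity-gradient laws and `curl f = 0`
  have hL3 := fderiv_equation_coord hrate hcont hmild hdiv ht x (EuclideanSpace.single 2 1) b
  have hLb := fderiv_equation_coord hrate hcont hmild hdiv ht x (EuclideanSpace.single b 1) 2
  rw [apply_apply_coord] at hL3 hLb
  obtain ⟨hc0, hc1⟩ := fderiv_residual_symm hrate hcont hmild hdiv ht x
  -- ## opaque names for the slope along the profile and for the horizontal gradient entry
  obtain ⟨M, hM⟩ : ∃ M : ℝ → EuclideanSpace ℝ (Fin 3) → ℝ, ∀ s y, M s y = m s (v s y 2) := ⟨_, fun _ _ => rfl⟩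
  obtain ⟨g, hg⟩ : ∃ g : ℝ → EuclideanSpace ℝ (Fin 3) → ℝ,
      ∀ s y, g s y = fderiv ℝ (v s) y (EuclideanSpace.single b 1) 2 := ⟨_, fun _ _ => rfl⟩
  have hMfun : ∀ s, M s = fun y => m s (v s y 2) := fun s => funext (hM s)
  have hgfun : ∀ s, g s = fun y => fderiv ℝ (v s) y (EuclideanSpace.single b 1) 2 := fun s => funext (hg s)
  -- ## regularity of the atoms
  have hθx : ContDiff ℝ ∞ (fun y => v t y 2) := contDiff_vert_slice hrate hcont hmild hdiv ht
  have hθt : DifferentiableAt ℝ (fun s => v s x 2) t := differentiableAt_vert_time hrate hcont hmild hdiv ht x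
  have hmt : ContDiff ℝ 2 (m t) := hm.comp (contDiff_const.prodMk contDiff_id)
  have hMx : ContDiff ℝ 2 (M t) := by
    rw [hMfun]; exact hmt.comp (hθx.of_le (by norm_cast))
  have hMt : DifferentiableAt ℝ (fun s => M s x) t := by
    have h1 : DifferentiableAt ℝ (uncurry m ∘ fun s => (s, v s x 2)) t :=
      ((hm.differentiable (by norm_num)) _).comp t (differentiableAt_id.prodMk hθt)
    have h2 : (fun s => M s x) = uncurry m ∘ fun s => (s, v s x 2) := by
      funext s; simp [hM]
    rw [h2]; exact h1
  have hgx : ContDiff ℝ ∞ (g t) := by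
    rw [hgfun]; exact contDiff_fderiv_coord hrate hcont hmild hdiv ht (EuclideanSpace.single b 1) 2
  have hgt : DifferentiableAt ℝ (fun s => g s x) t := by
    have h := differentiableAt_fderiv_slice_coord hrate hcont hmild hdiv ht x (EuclideanSpace.single b 1) 2
    have h2 : (fun s => g s x) = fun s => fderiv ℝ (v s) x (EuclideanSpace.single b 1) 2 := funext fun s => hg s x
    rw [h2]; exact h
  -- ## the constrained entry `∂₂v_b = M·g` near `t` (in time, at `x`) and near `x` (in space, at time `t`)
  have hO_t : ∀ᶠ s in 𝓝 t, (s, x) ∈ O :=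
    (continuous_id.prodMk continuous_const).continuousAt.preimage_mem_nhds (hO.mem_nhds hxO)
  have hO_x : ∀ᶠ y in 𝓝 x, (t, y) ∈ O :=
    (continuous_const.prodMk continuous_id).continuousAt.preimage_mem_nhds (hO.mem_nhds hxO)
  have hfun_t : (fun s => fderiv ℝ (v s) x (EuclideanSpace.single 2 1) b) =ᶠ[𝓝 t] fun s => M s x * g s x := by
    filter_upwards [hO_t] with s hs'
    rw [hM, hg]; exact hslope (s, x) hs' b hb
  have hfun_x : (fun y => fderiv ℝ (v t) y (EuclideanSpace.single 2 1) b) =ᶠ[𝓝 x] fun y => M t y * g t y := by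
    filter_upwards [hO_x] with y hy
    rw [hM, hg]; exact hslope (t, y) hy b hb
  -- ## Leibniz: `𝓛(M g) = M 𝓛g + g 𝓛M − 2 Σᵢ ∂ᵢM ∂ᵢg`
  have hLeib := material_mul (θ₁ := M) (θ₂ := g) (t := t) (x := x) (v t x) hMt hgt hMx (hgx.of_le (by norm_cast))
  -- ## the re-gauge calculus for `𝓛M` and the vertical momentum equation `𝓛v₂ = f₂`
  have hLM : deriv (fun s => M s x) t + fderiv ℝ (M t) x (v t x) - Δ (M t) x =
      deriv (fun τ => m τ (v t x 2)) t
        + deriv (m t) (v t x 2) * (timeDerivWithin (Iio 0) v t x + convect (v t) (v t) x - Δ (v t) x) 2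
        - deriv (deriv (m t)) (v t x 2) * ∑ i : Fin 3, fderiv ℝ (v t) x (EuclideanSpace.single i 1) 2 ^ 2 := by
    have h := material_regauge (θ := fun s y => v s y 2) (G := m) (t := t) (x := x) (v t x) hm hθt
      (hθx.of_le (by norm_cast))
    have e1 : (fun s => M s x) = fun s => m s (v s x 2) := funext fun s => hM s x
    rw [e1, hMfun t, h, material_vert_eq_residual hrate hcont hmild hdiv ht x]
    have e2 : ∀ i : Fin 3, fderiv ℝ (fun y => v t y 2) x (EuclideanSpace.single i 1) =
        fderiv ℝ (v t) x (EuclideanSpace.single i 1) 2 := fun i => FluidPDE.fderiv_apply_coord (hsd x) _ 2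
    simp only [e2]
  -- the horizontal derivatives of `M`: `∂ᵢM = m_s ∂ᵢv₂`
  have hdM : ∀ i : Fin 3, fderiv ℝ (M t) x (EuclideanSpace.single i 1) =
      deriv (m t) (v t x 2) * fderiv ℝ (v t) x (EuclideanSpace.single i 1) 2 := by
    intro i
    have hθd : DifferentiableAt ℝ (fun y => v t y 2) x := (hθx.differentiable (by simp)) x
    have h := ((hmt.differentiable (by norm_num)) (v t x 2)).hasDerivAt.comp_hasFDerivAt x hθd.hasFDerivAt
    rw [hMfun t, show (fun y => m t (v t y 2)) = m t ∘ fun y => v t y 2 from rfl, h.fderiv]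
    simp only [FunLike.coe_smul, Pi.smul_apply, smul_eq_mul]
    rw [FluidPDE.fderiv_apply_coord (hsd x)]
  -- ## assemble: the law for `∂₂v_b`, rewritten through `M g`
  have hL3' : M t x * (deriv (fun s => g s x) t + fderiv ℝ (g t) x (v t x) - Δ (g t) x)
      + g t x * (deriv (fun s => M s x) t + fderiv ℝ (M t) x (v t x) - Δ (M t) x)
      - 2 * ∑ i : Fin 3, fderiv ℝ (M t) x (EuclideanSpace.single i 1) * fderiv ℝ (g t) x (EuclideanSpace.single i 1) =
      fderiv ℝ (fun y => timeDerivWithin (Iio 0) v t y + convect (v t) (v t) y - Δ (v t) y) x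
          (EuclideanSpace.single 2 1) b -
        ∑ j : Fin 3, fderiv ℝ (v t) x (EuclideanSpace.single 2 1) j *
          fderiv ℝ (v t) x (EuclideanSpace.single j 1) b := by
    rw [← hLeib, ← hL3, hfun_t.deriv_eq, hfun_x.fderiv_eq, (InnerProductSpace.laplacian_congr_nhds hfun_x).self_of_nhds]
  -- `𝓛g` from the law for `∂_b v₂`
  have hLg : deriv (fun s => g s x) t + fderiv ℝ (g t) x (v t x) - Δ (g t) x =
      fderiv ℝ (fun y => timeDerivWithin (Iio 0) v t y + convect (v t) (v t) y - Δ (v t) y) x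
          (EuclideanSpace.single b 1) 2 -
        ∑ j : Fin 3, fderiv ℝ (v t) x (EuclideanSpace.single b 1) j *
          fderiv ℝ (v t) x (EuclideanSpace.single j 1) 2 := by
    have e1 : (fun s => g s x) = fun s => fderiv ℝ (v s) x (EuclideanSpace.single b 1) 2 := funext fun s => hg s x
    rw [e1, hgfun t, ← hLb]
  rw [hLg, hLM] at hL3'
  simp only [hdM] at hL3'
  have hgtx : g t x = fderiv ℝ (v t) x (EuclideanSpace.single b 1) 2 := hg t x
  rw [hgtx, hgfun t] at hL3'
  -- ## pointwise inputs: the slope at `(t,x)` and `∂₀v₁ = ∂₁v₀`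
  have h20 : fderiv ℝ (v t) x (EuclideanSpace.single 2 1) 0 =
      m t (v t x 2) * fderiv ℝ (v t) x (EuclideanSpace.single 0 1) 2 := hslope (t, x) hxO 0 (by decide)
  have h21 : fderiv ℝ (v t) x (EuclideanSpace.single 2 1) 1 =
      m t (v t x 2) * fderiv ℝ (v t) x (EuclideanSpace.single 1 1) 2 := hslope (t, x) hxO 1 (by decide)
  have hω2 : curl (v t) x 2 = 0 := by simpa [EuclideanSpace.inner_single_right] using hpol t ht x
  have hsym : fderiv ℝ (v t) x (EuclideanSpace.single 0 1) 1 = fderiv ℝ (v t) x (EuclideanSpace.single 1 1) 0 := by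
    have h : fderiv ℝ (v t) x (EuclideanSpace.single 0 1) 1 - fderiv ℝ (v t) x (EuclideanSpace.single 1 1) 0 = 0 := by
      simpa [curl] using hω2
    linarith
  have hMtx : M t x = m t (v t x 2) := hM t x
  rw [hMtx] at hL3'
  -- ## name the atoms and finish by linear algebra
  obtain ⟨D, hD⟩ : ∃ D : EuclideanSpace ℝ (Fin 3) →L[ℝ] EuclideanSpace ℝ (Fin 3), fderiv ℝ (v t) x = D := ⟨_, rfl⟩
  obtain ⟨G', hG'⟩ : ∃ G' : EuclideanSpace ℝ (Fin 3) →L[ℝ] EuclideanSpace ℝ (Fin 3),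
      fderiv ℝ (fun y => timeDerivWithin (Iio 0) v t y + convect (v t) (v t) y - Δ (v t) y) x = G' := ⟨_, rfl⟩
  generalize hF2 : (timeDerivWithin (Iio 0) v t x + convect (v t) (v t) x - Δ (v t) x) 2 = F₂ at hL3' ⊢
  generalize hM0 : m t (v t x 2) = M₀ at hL3' h20 h21 ⊢
  generalize hM1 : deriv (m t) (v t x 2) = M₁ at hL3' ⊢
  generalize hM2 : deriv (deriv (m t)) (v t x 2) = M₂ at hL3' ⊢
  generalize hMt' : deriv (fun τ => m τ (v t x 2)) t = Mt at hL3' ⊢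
  generalize hS : (fun i : Fin 3 => fderiv ℝ (fun y => fderiv ℝ (v t) y (EuclideanSpace.single b 1) 2) x
      (EuclideanSpace.single i 1)) = S at hL3' ⊢
  have hS' : ∀ i : Fin 3, fderiv ℝ (fun y => fderiv ℝ (v t) y (EuclideanSpace.single b 1) 2) x
      (EuclideanSpace.single i 1) = S i := fun i => by rw [← hS]
  simp only [hS'] at hL3' ⊢
  rw [hD] at hL3' h20 h21 hsym ⊢
  rw [hG'] at hL3' hc0 hc1 ⊢
  rcases hb' with rfl | rfl
  · simp only [Fin.sum_univ_three, Fin.isValue] at hL3' ⊢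
    linear_combination (-1 : ℝ) * hL3' + hc0 + (D (EuclideanSpace.single 0 1) 0 + D (EuclideanSpace.single 2 1) 2) * h20
      + D (EuclideanSpace.single 1 1) 0 * h21 - M₀ * D (EuclideanSpace.single 1 1) 2 * hsym
  · simp only [Fin.sum_univ_three, Fin.isValue] at hL3' ⊢
    linear_combination (-1 : ℝ) * hL3' + hc1 + D (EuclideanSpace.single 0 1) 1 * h20
      + (D (EuclideanSpace.single 1 1) 1 + D (EuclideanSpace.single 2 1) 2) * h21
      + M₀ * D (EuclideanSpace.single 0 1) 2 * hsym

/-! ### B1 + B2: the pressure law on the z_shock Aut column -/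

omit hrate hcont hmild hdiv in
/-- **Smooth cut-off of an analytic germ.**  A real function which is `C^ω` at a point `a` of a finite-dimensional real normed space
agrees, on a neighbourhood of `a`, with a GLOBALLY `Cⁿ` function (multiply by a bump function centred at `a` whose support lies in a
ball where the function is analytic). [folklore] -/
theorem exists_contDiff_eventuallyEq_of_contDiffAt {F : Type*} [NormedAddCommGroup F] [NormedSpace ℝ F]
    [FiniteDimensional ℝ F] {f : F → ℝ} {a : F} (hf : ContDiffAt ℝ ω f a) (n : ℕ∞) :
    ∃ g : F → ℝ, ContDiff ℝ n g ∧ g =ᶠ[𝓝 a] f := by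
  -- `f` is `C^ω` on an open neighbourhood `U` of `a`
  obtain ⟨U, hUsub, hUo, haU⟩ := _root_.mem_nhds_iff.1 (hf.eventually (by simp))
  -- a closed ball inside `U` and a bump function supported in it
  obtain ⟨r, hr, hrU⟩ := Metric.nhds_basis_closedBall.mem_iff.1 (hUo.mem_nhds haU)
  let φ : ContDiffBump a := ⟨r / 2, r, half_pos hr, half_lt_self hr⟩
  refine ⟨fun y => φ y * f y, ?_, ?_⟩
  · rw [contDiff_iff_contDiffAt]
    intro y
    by_cases hy : y ∈ U
    · have hfy : ContDiffAt ℝ ω f y := hUsub hy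
      exact φ.contDiff.contDiffAt.mul (hfy.of_le le_top)
    · -- outside `U ⊇ closedBall a r = tsupport φ` the product vanishes near `y`
      have hy' : y ∉ tsupport (φ : F → ℝ) := by
        intro h
        rw [φ.tsupport_eq] at h
        exact hy (hrU h)
      have h0 : (fun y => φ y * f y) =ᶠ[𝓝 y] fun _ => 0 := by
        filter_upwards [notMem_tsupport_iff_eventuallyEq.1 hy'] with z hz
        simp [hz]
      exact contDiffAt_const.congr_of_eventuallyEq h0
  · filter_upwards [φ.eventuallyEq_one] with y hy
    simp [hy]

/-- ★ **B1 + B2 — the (SF) pressure law holds on the z_shock Aut column.**  Class binders of `stub_zShockThickAut` (Type-I rate,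
continuity, Oseen identity, divergence-free, poloidal) + the stub's LOCAL autonomy clause on an open nonempty `W₁` of the backward slab
(`∂_z v_b = g(t, v₂)·∂_b v₂` on `W₁`, SOME `g`).  Then at EVERY `t < 0` and EVERY `x` with `∇ₕv₂(t,x) ≠ 0` there are a slope function
`m : ℝ → ℝ → ℝ`, GLOBALLY `C²` and real-analytic at `(t, v₂(t,x))`, and an open space–time `O ∋ (t,x)` inside the slab such that
(i) the (SF) constraint `∂_z v_b = m(s, v₂)·∂_b v₂` holds on `O` for both `b ≠ 2`, and (ii) at EVERY point of `O` the pressure law of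
`…SlopeFunctionPressure.slopeFunction_pressure` holds for both `b ≠ 2`. [folklore] -/
theorem slopeFunction_pressure_of_class_autonomy
    (hpol : ∀ s < 0, ∀ y, ⟪curl (v s) y, EuclideanSpace.single 2 1⟫_ℝ = 0)
    {W₁ : Set (ℝ × EuclideanSpace ℝ (Fin 3))} (hW₁ : IsOpen W₁) (hW₁s : W₁ ⊆ Set.Iio (0 : ℝ) ×ˢ Set.univ)
    (hW₁ne : W₁.Nonempty) {g : ℝ → ℝ → ℝ}
    (haut : ∀ z ∈ W₁, ∀ b : Fin 3, b ≠ 2 →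
      fderiv ℝ (v z.1) z.2 (EuclideanSpace.single 2 1) b =
        g z.1 (v z.1 z.2 2) * fderiv ℝ (v z.1) z.2 (EuclideanSpace.single b 1) 2)
    {t : ℝ} (ht : t < 0) {x : EuclideanSpace ℝ (Fin 3)}
    (hx : fderiv ℝ (v t) x (EuclideanSpace.single 0 1) 2 ≠ 0 ∨ fderiv ℝ (v t) x (EuclideanSpace.single 1 1) 2 ≠ 0) :
    ∃ m : ℝ → ℝ → ℝ, ContDiff ℝ 2 (uncurry m) ∧ ContDiffAt ℝ ω (uncurry m) (t, v t x 2) ∧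
      ∃ O : Set (ℝ × EuclideanSpace ℝ (Fin 3)), IsOpen O ∧ (t, x) ∈ O ∧ O ⊆ Set.Iio (0 : ℝ) ×ˢ Set.univ ∧
        (∀ z ∈ O, ∀ b : Fin 3, b ≠ 2 →
          fderiv ℝ (v z.1) z.2 (EuclideanSpace.single 2 1) b =
            m z.1 (v z.1 z.2 2) * fderiv ℝ (v z.1) z.2 (EuclideanSpace.single b 1) 2) ∧
        ∀ z ∈ O, ∀ b : Fin 3, b ≠ 2 →
          (1 - m z.1 (v z.1 z.2 2)) *
              fderiv ℝ (fun y => timeDerivWithin (Iio 0) v z.1 y + convect (v z.1) (v z.1) y - Δ (v z.1) y) z.2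
                (EuclideanSpace.single b 1) 2 =
            fderiv ℝ (v z.1) z.2 (EuclideanSpace.single b 1) 2 *
                (deriv (fun τ => m τ (v z.1 z.2 2)) z.1
                  + deriv (m z.1) (v z.1 z.2 2) *
                      (timeDerivWithin (Iio 0) v z.1 z.2 + convect (v z.1) (v z.1) z.2 - Δ (v z.1) z.2) 2
                  - deriv (deriv (m z.1)) (v z.1 z.2 2) *
                      ∑ i : Fin 3, fderiv ℝ (v z.1) z.2 (EuclideanSpace.single i 1) 2 ^ 2)
              - 2 * deriv (m z.1) (v z.1 z.2 2) * ∑ i : Fin 3, fderiv ℝ (v z.1) z.2 (EuclideanSpace.single i 1) 2 *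
                  fderiv ℝ (fun y => fderiv ℝ (v z.1) y (EuclideanSpace.single b 1) 2) z.2 (EuclideanSpace.single i 1) := by
  -- ## B1: an analytic local slope function `m₀` on an open `O₀ ∋ (t, x)`
  obtain ⟨m₀, hm₀, O₀, hO₀, hxO₀, hO₀s, hslope₀⟩ :=
    slopeFunction_spaceTime_of_class_autonomy C v hrate hcont hmild hdiv hpol hW₁ hW₁s hW₁ne haut ht hx
  -- ## cut-off: a globally `C²` function agreeing with `m₀` near `(t, v₂(t,x))`
  obtain ⟨M, hMc, hMeq⟩ := exists_contDiff_eventuallyEq_of_contDiffAt hm₀ 2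
  obtain ⟨A, hAsub, hAo, hpA⟩ := _root_.mem_nhds_iff.1 hMeq
  set m : ℝ → ℝ → ℝ := fun τ w => M (τ, w) with hm
  have hmM : uncurry m = M := by funext q; rfl
  -- ## the open set `O = O₀ ∩ {(s, v₂(s,y)) ∈ A}`
  have hWc : ContinuousOn (fun z : ℝ × EuclideanSpace ℝ (Fin 3) => (z.1, v z.1 z.2 2)) O₀ := by
    have h1 : ContinuousOn (uncurry v) O₀ := hcont.mono hO₀s
    have h2 : ContinuousOn (fun z : ℝ × EuclideanSpace ℝ (Fin 3) => v z.1 z.2 2) O₀ :=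
      ((EuclideanSpace.proj (2 : Fin 3) : EuclideanSpace ℝ (Fin 3) →L[ℝ] ℝ).continuous.comp_continuousOn h1)
    exact continuousOn_fst.prodMk h2
  set O : Set (ℝ × EuclideanSpace ℝ (Fin 3)) := O₀ ∩ (fun z => (z.1, v z.1 z.2 2)) ⁻¹' A with hO
  have hOo : IsOpen O := hWc.isOpen_inter_preimage hO₀ hAo
  have hxO : (t, x) ∈ O := ⟨hxO₀, hpA⟩
  have hOs : O ⊆ Set.Iio (0 : ℝ) ×ˢ Set.univ := fun z hz => hO₀s hz.1
  have hslope : ∀ z ∈ O, ∀ b : Fin 3, b ≠ 2 →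
      fderiv ℝ (v z.1) z.2 (EuclideanSpace.single 2 1) b =
        m z.1 (v z.1 z.2 2) * fderiv ℝ (v z.1) z.2 (EuclideanSpace.single b 1) 2 := by
    intro z hz b hb
    have hmz : m z.1 (v z.1 z.2 2) = m₀ z.1 (v z.1 z.2 2) := hAsub hz.2
    rw [hmz]
    exact hslope₀ z hz.1 b hb
  refine ⟨m, ?_, ?_, O, hOo, hxO, hOs, hslope, fun z hz b hb => ?_⟩
  · rw [hmM]; exact hMc
  · rw [hmM]; exact hm₀.congr_of_eventuallyEq hMeq
  · have hz1 : z.1 < 0 := (Set.mem_prod.1 (hOs hz)).1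
    have hm2 : ContDiff ℝ 2 (uncurry m) := by rw [hmM]; exact hMc
    exact slopeFunction_pressure_local hrate hcont hmild hdiv hpol hm2 hz1 z.2 hOo hz hslope hb

end Class

end Summit.NavierStokesRegularity.NavierStokesRegularity.Theorems.PoloidalWindowDoorPoloidalWindowRigidityZShockSlopeFunctionPressureLocal

end
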